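import Literature.InformationTheory.QuantumCodes.ToricCodeThreshold
import HarnessLib

/-!
# Minimum-weight recovery on the toric code: the half-weight inequality of
# Dennis–Kitaev–Landahl–Preskill §5.2 (index-generic form, for the `ZDecoder` vocabulary)

Topic `Literature/InformationTheory/QuantumCodes` (venture QEC, LADDER-QEC Q5; companion of
`ToricCodeThreshold.lean`). Theorem-only file, all PROVED, 0 facts. This is the coding step of the
DKLP counting bound for the toric code, stated for the objects of `ToricCodeThreshold.lean`
(`Chain L = Edge L → ZMod 2`, `syn L`, `cycles L`, a decoder `D : ZDecoder L` with
`D.IsMinWeight (syn L) (cycles L) hammingNorm`): "our procedure for constructing `E_min` ensures that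
… [eq. (e_m_ineq2)] … This must be so because the `e` links and the `m` links share the same
boundary; were eq. (e_m_ineq2) not satisfied, we could replace the `m` links in `E_min` by the `e`
links and thereby increase the value …" — i.e. for every set `A` of links on which the discrepancy
`E + E_min` restricts to a CYCLE, the minimal chain carries at most as many of the links of `A` as
the actual error does, hence **at least half of the links of `A` are actual errors**:
`|A| ≤ 2 |A ∩ supp E|` (`card_le_two_mul_card_inter_supp`). The same inequality for Fin-indexed
check matrices is `card_le_two_mul_card_inter_of_minWeight` (`MinWeightDecodingClusters.lean`,
Kovalev–Pryadko / Gottesman); here it is proved directly for the torus-indexed chains so that the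
discharge of `ToricCode.toricThreshold_of_sawCountBound` can apply it to self-avoiding polygons
`A ⊆ supp(E + E_min)` without reindexing.

* `Chain.restrict A z` — the chain `z` restricted to the links in `A` (zero elsewhere);
* `syn_decode_eq` — a minimum-weight decoder reproduces the syndrome: `∂(D(∂e)) = ∂e`;
* `hammingNorm_decode_le_of_mem_cycles` — `|E_min| ≤ |E_min + c|` for every cycle `c`;
* **`card_le_two_mul_card_inter_supp`** — the half-weight inequality.

## References

* [DennisEtAl2002] E. Dennis, A. Kitaev, A. Landahl, J. Preskill, *Topological quantum memory*,
  J. Math. Phys. 43 (2002) 4452–4505, arXiv:quant-ph/0110143, §5.2 eqs. (e_m_ineq1)–(e_ineq).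
-/

namespace Literature.InformationTheory.QuantumCodes

open Finset Matrix

namespace ToricCode

variable {L : ℕ}

/-- The restriction `z|_A` of a chain to a set of links (zero off `A`).
[cite: DennisEtAl2002, §5.2 (the e links and the m links of a path)] -/
def Chain.restrict (A : Finset (Edge L)) (z : Chain L) : Chain L :=
  fun ℓ => if ℓ ∈ A then z ℓ else 0

/-- In `ℤ₂`, `a + a = 0`. [folklore] -/
private theorem zmod2_add_self (a : ZMod 2) : a + a = 0 := by
  revert a; decide

variable [NeZero L]

/-- The syndrome map is additive (`∂` is linear). [cite: DennisEtAl2002, §4.3 (∂(S + E) = ∂S + ∂E)] -/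
theorem syn_add (x y : Chain L) : syn L (x + y) = syn L x + syn L y := by
  unfold syn
  exact mulVec_add _ _ _

/-- A minimum-weight decoder reproduces the observed syndrome: `∂(D(∂e)) = ∂e` (its output has "the
same boundary as the syndrome chain"). [cite: DennisEtAl2002, §5.1 eq. (∂E_min = ∂S)] -/
theorem syn_decode_eq {D : ZDecoder L} (hD : D.IsMinWeight (syn L) (cycles L) hammingNorm)
    (e : Chain L) : syn L (D (syn L e)) = syn L e := by
  have h := hD.add_mem e
  simp only [cycles, Set.mem_setOf_eq, syn_add] at h
  -- `∂e' + ∂e = 0` in characteristic two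
  have : syn L (D (syn L e)) = syn L (D (syn L e)) + (syn L (D (syn L e)) + syn L e) := by
    rw [h, add_zero]
  rw [this, ← add_assoc]
  funext v
  simp only [Pi.add_apply, zmod2_add_self, zero_add]

/-- **Minimality against cycles**: adding any cycle `c` to the minimal recovery chain cannot
decrease its weight, `|E_min| ≤ |E_min + c|` ("we could replace the `m` links in `E_min` by the `e`
links"). [cite: DennisEtAl2002, §5.2 eq. (e_m_ineq2)] -/
theorem hammingNorm_decode_le_of_mem_cycles {D : ZDecoder L}
    (hD : D.IsMinWeight (syn L) (cycles L) hammingNorm) (e : Chain L) {c : Chain L}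
    (hc : c ∈ cycles L) : hammingNorm (D (syn L e)) ≤ hammingNorm (D (syn L e) + c) := by
  have hsyn : syn L (D (syn L e) + c) = syn L e := by
    rw [syn_add, syn_decode_eq hD e]
    simp only [cycles, Set.mem_setOf_eq] at hc
    rw [hc, add_zero]
  have h := hD.weight_le (D (syn L e) + c)
  rwa [hsyn] at h

omit [NeZero L] in
/-- On a link of the discrepancy `E + E_min`, exactly one of `E`, `E_min` is present.
[cite: DennisEtAl2002, §5.2 (each link of the path is in E or in E_min)] -/
theorem ne_zero_iff_eq_zero_of_add_ne_zero {a b : ZMod 2} (h : a + b ≠ 0) : a ≠ 0 ↔ b = 0 := by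
  revert a b; decide

/-- **The half-weight inequality** (DKLP §5.2): let `D` be a minimum-weight decoder, `e` an error
chain, `z = e + D(∂e)` the discrepancy, and `A ⊆ supp z` a set of links on which `z` restricts to a
cycle (`∂(z|_A) = 0`; e.g. `A` = a closed path contained in `E + E_min`). Then at least half of the
links of `A` carry actual errors: `|A| ≤ 2 |A ∩ supp e|` ("`H_e ≥ H/2`", from eqs. (e_m_ineq1),
(e_m_ineq2)). [cite: DennisEtAl2002, §5.2 eq. (e_ineq)] -/
theorem card_le_two_mul_card_inter_supp {D : ZDecoder L}
    (hD : D.IsMinWeight (syn L) (cycles L) hammingNorm) (e : Chain L) {A : Finset (Edge L)}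
    (hA : A ⊆ supp (e + D (syn L e)))
    (hcycle : Chain.restrict A (e + D (syn L e)) ∈ cycles L) :
    A.card ≤ 2 * (A ∩ supp e).card := by
  classical
  set e' : Chain L := D (syn L e) with he'
  set c : Chain L := Chain.restrict A (e + e') with hc
  -- (1) minimality: `|e'| ≤ |e' + c|`
  have hmin : hammingNorm e' ≤ hammingNorm (e' + c) := hammingNorm_decode_le_of_mem_cycles hD e hcycle
  -- (2) on `A`, `e' + c = e`; off `A`, `e' + c = e'`
  have hon : ∀ ℓ ∈ A, (e' + c) ℓ = e ℓ := by
    intro ℓ hℓ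
    simp only [hc, Chain.restrict, Pi.add_apply, if_pos hℓ]
    rw [add_comm (e ℓ) (e' ℓ), ← add_assoc, zmod2_add_self, zero_add]
  have hoff : ∀ ℓ, ℓ ∉ A → (e' + c) ℓ = e' ℓ := by
    intro ℓ hℓ
    simp only [hc, Chain.restrict, Pi.add_apply, if_neg hℓ, add_zero]
  -- (3) weights split along `A`
  have hsplit : ∀ f : Chain L, hammingNorm f =
      (A.filter fun ℓ => f ℓ ≠ 0).card + ((univ \ A).filter fun ℓ => f ℓ ≠ 0).card := by
    intro f
    have h1 : (univ.filter fun ℓ : Edge L => f ℓ ≠ 0) =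
        (A.filter fun ℓ => f ℓ ≠ 0) ∪ ((univ \ A).filter fun ℓ => f ℓ ≠ 0) := by
      rw [← filter_union, union_sdiff_of_subset (subset_univ A)]
    have h2 : Disjoint (A.filter fun ℓ => f ℓ ≠ 0) ((univ \ A).filter fun ℓ => f ℓ ≠ 0) :=
      disjoint_filter_filter (disjoint_sdiff)
    change (univ.filter fun ℓ : Edge L => f ℓ ≠ 0).card = _
    rw [h1, card_union_of_disjoint h2]
  have hA_on : (A.filter fun ℓ => (e' + c) ℓ ≠ 0) = A.filter fun ℓ => e ℓ ≠ 0 :=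
    filter_congr fun ℓ hℓ => by rw [hon ℓ hℓ]
  have hA_off : ((univ \ A).filter fun ℓ => (e' + c) ℓ ≠ 0) = (univ \ A).filter fun ℓ => e' ℓ ≠ 0 :=
    filter_congr fun ℓ hℓ => by rw [hoff ℓ (mem_sdiff.1 hℓ).2]
  have hmin' : (A.filter fun ℓ => e' ℓ ≠ 0).card ≤ (A.filter fun ℓ => e ℓ ≠ 0).card := by
    have := hmin
    rw [hsplit e', hsplit (e' + c), hA_on, hA_off] at this
    omega
  -- (4) every link of `A` is in exactly one of `supp e`, `supp e'`
  have hpart : A.card = (A.filter fun ℓ => e ℓ ≠ 0).card + (A.filter fun ℓ => e' ℓ ≠ 0).card := by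
    have h1 : (A.filter fun ℓ => e' ℓ ≠ 0) = A.filter fun ℓ => ¬ (e ℓ ≠ 0) := by
      refine filter_congr fun ℓ hℓ => ?_
      have hz : (e + e') ℓ ≠ 0 := by
        have := hA hℓ
        simpa [supp] using this
      rw [Pi.add_apply] at hz
      constructor
      · intro h' h''
        exact h' (((ne_zero_iff_eq_zero_of_add_ne_zero hz).1 h''))
      · intro h'
        push Not at h'
        intro h''
        rw [h', zero_add] at hz
        exact hz h''
    rw [h1, card_filter_add_card_filter_not]
  have hAe : (A.filter fun ℓ => e ℓ ≠ 0) = A ∩ supp e := by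
    ext ℓ; simp [supp, mem_filter, mem_inter]
  rw [hAe] at hpart hmin'
  omega

end ToricCode

end Literature.InformationTheory.QuantumCodes
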